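import Literature.AlgebraicGeometry.AbelianSchemes.IsLambdaOfAtAlongIsogeny
import Literature.AlgebraicGeometry.AbelianSchemes.PoincareSheafBiadditive
import HarnessLib

/-!
# `IsLambdaOfAt` is additive: `λ̄₁ = Λ(𝒪(Θ₁))`, `λ̄₂ = Λ(𝒪(Θ₂))` ⇒ `λ̄₁·λ̄₂ = Λ(𝒪(Θ₁ + Θ₂))`, and `λ̄⁻¹ = Λ(𝒪(−Θ))`

Layer `Literature/AlgebraicGeometry/AbelianSchemes`, namespace `Literature.AlgebraicGeometry.AbelianSchemes.AbelianSchemeOver`.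
THEOREMS ONLY.  Cell hodgecm-mathlib (D-0151), Hecke-link socket (B), (X-amp) «`exists_ample` for the descended `λ_B`» plan of record
(B-plan1 (g14) 22:05:45Z): fact (F4) of B-p15 (g10)'s census `CENSUS-Xamp3-existsAmple` — the Bezout assembly
`Θ_B := Θ₀ − ((c−1)/2) • E` needs `IsLambdaOfAt` to be a HOMOMORPHISM in `(λ, Θ)`; the tree had the power case only (★ (α2)
`IsLambdaOfAt.pow_nsmul`, p744441).  [MumfordFogartyKirwan1994] Ch. 6 §2 Def. 6.2: `Λ(L ⊗ M) = Λ(L) + Λ(M)`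
(`T_x^*(L⊗M) ⊗ (L⊗M)⁻¹ = (T_x^*L ⊗ L⁻¹) ⊗ (T_x^*M ⊗ M⁻¹)`); [MumfordAV1970] §8 (iv): `Â → Pic(A)` is a homomorphism — in the tree:
★ `DualPair.nonempty_pullbackP_mul_iso` (`(1 × g₁g₂)^*𝒫 ≅ (1 × g₁)^*𝒫 ⊗ (1 × g₂)^*𝒫`, p745559) read on the slices `A_s × {λ̄ᵢ(P)}`, then the
rank-one dictionary (★ `nonempty_iso_iff_detClass_eq`, ★ `detClass_translateTensorDual_eq_cechClass_weilDiv`, ★ `cechClass_add`).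

* §1 `valueAt_mul`, `sliceAt_obj_eq_pullbackP` — plumbing: `λ̄₁λ̄₂(P) = λ̄₁(P)·λ̄₂(P)` as `Spec Ω`-points of `Â`, and the slice
  pull-back IS `DualPair.pullbackP` at the value (`rfl`);
* §2 **`IsLambdaOfAt.mul_add`** (needs the unit hypothesis `hD : 𝒫|_{A × {ε}} ≅ 𝒪` of ★ `PoincareSheafBiadditive` and `S` reduced,
  locally Noetherian) and the CANCELLATION form **`IsLambdaOfAt.of_mul_add`** (`λ̄₁λ̄₂ = Λ(𝒪(Θ₁+Θ₂))`, `λ̄₂ = Λ(𝒪(Θ₂))` ⇒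
  `λ̄₁ = Λ(𝒪(Θ₁))`) — the shape the Bezout assembly uses (`λ_B · (λ_B²)^k = λ_B^c`, `Θ_B + k•E ∼ Θ₀`), so that no inverse
  slice / `−Θ` bookkeeping is needed (with ★ `pow_nsmul` for `(λ_B²)^k ↔ k•E`).

## References

* [MumfordFogartyKirwan1994] D. Mumford, J. Fogarty, F. Kirwan, *Geometric Invariant Theory*, 3rd ed., Ch. 6 §2 Definition 6.2
  (p. 120) (`Λ(L)(x) = T_x^*L ⊗ L⁻¹`, additive in `L`).
* [MumfordAV1970] D. Mumford, *Abelian Varieties* (1970), §8 (pp. 74–75) (`φ_{L⊗M} = φ_L + φ_M`; `Â → Pic⁰` a homomorphism).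
-/

noncomputable section

universe u

open CategoryTheory CategoryTheory.Limits AlgebraicGeometry MonoidalCategory

namespace Literature.AlgebraicGeometry.AbelianSchemes

open Literature.AlgebraicGeometry.Motives Literature.AlgebraicGeometry.AbelianVarieties Literature.AlgebraicGeometry.Modules
open scoped MonObj

namespace AbelianSchemeOver

variable {S : Scheme.{u}} (A : AbelianSchemeOver S) (D : A.DualPair) {Ω : Type u} [Field Ω] (s : Spec (.of Ω) ⟶ S)

/-! ### §1 Plumbing: values of a product, slices as `pullbackP` -/

/-- The `Ω`-point `P` of the fibre `A_s` as an `S`-morphism `Spec Ω → A` over `s` (non-Prop plumbing, local).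
[cite: MumfordFogartyKirwan1994, Ch. 6 §2 Definition 6.3 (p. 120)] -/
theorem fibrePointToLeft_comp_hom' (P : (A.fibre s).toAbelianVariety.Points Ω) :
    A.fibrePointToLeft s P ≫ A.X.hom = (Over.mk s).hom := A.fibrePointToLeft_comp_hom s P

/-- **`(λ̄₁·λ̄₂)(P) = λ̄₁(P)·λ̄₂(P)`**: the value of a product of homomorphisms is the product of the values in the group of
`Spec Ω`-points of `Â` over `s` (Mathlib `MonObj.comp_mul`). [cite: MumfordAV1970, §8 (pp. 74–75)] -/
theorem valueAt_mul (lam₁ lam₂ : A.X ⟶ D.hat.X) (P : (A.fibre s).toAbelianVariety.Points Ω) :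
    A.valueAt s D (lam₁ * lam₂) P =
      ((Over.homMk (A.fibrePointToLeft s P) (A.fibrePointToLeft_comp_hom s P) : Over.mk s ⟶ A.X) ≫ lam₁ *
        (Over.homMk (A.fibrePointToLeft s P) (A.fibrePointToLeft_comp_hom s P) : Over.mk s ⟶ A.X) ≫ lam₂).left := by
  rw [← MonObj.comp_mul, Over.comp_left]
  rfl

/-- The value `λ̄(P)` as the underlying map of the `Over`-composite `P ≫ λ`. [cite: MumfordFogartyKirwan1994, Ch. 6 §2 Definition 6.3 (p. 120)] -/
theorem valueAt_eq_homMk_comp_left (lam : A.X ⟶ D.hat.X) (P : (A.fibre s).toAbelianVariety.Points Ω) :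
    A.valueAt s D lam P =
      ((Over.homMk (A.fibrePointToLeft s P) (A.fibrePointToLeft_comp_hom s P) : Over.mk s ⟶ A.X) ≫ lam).left := by
  rw [Over.comp_left]
  rfl

/-- **The slice pull-back `𝒫|_{A_s × {λ̄(P)}}` IS `(1_A × λ̄(P))^*𝒫 = DualPair.pullbackP`** (same `pullback.lift`; `rfl`).
[cite: MilneAV2008, I §8 pp. 36–37] -/
theorem sliceAt_obj_eq_pullbackP (lam : A.X ⟶ D.hat.X) (P : (A.fibre s).toAbelianVariety.Points Ω) :
    (Scheme.Modules.pullback (A.sliceAt s D lam P)).obj D.P = D.pullbackP s (A.valueAt s D lam P) (A.valueAt_comp_hom s D lam P) :=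
  rfl

/-- `[𝒪(−D)] = [𝒪(D)]⁻¹` in `Ȟ¹(X, 𝒪_X^×)` for any integral `X` (`D + (−D) ∼ 0`; ★ `cechClass_add`; the tree's
`AbelianVariety.cechClass_neg_eq_inv` is the same over an abelian variety). [cite: MumfordAV1970, §8 (pp. 74–75)] -/
theorem cechClass_neg_eq_inv' {X : Scheme.{u}} [IsIntegral X] (E : CartierDivisor X) : (-E).cechClass = (E.cechClass)⁻¹ := by
  have h0 : (E + -E).cechClass = 1 := by
    rw [(CartierDivisor.cechClass_eq_iff_linEquiv _ _).2
      (CartierDivisor.LinEquiv.add_neg (CartierDivisor.LinEquiv.refl E)), CartierDivisor.cechClass_zero]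
  rw [CartierDivisor.cechClass_add] at h0
  exact eq_inv_of_mul_eq_one_right h0

/-- Commutative-group bookkeeping `a₁⁻¹(a₂⁻¹(t₁t₂))·(a₂⁻¹t₂)⁻¹ = a₁⁻¹t₁` (via `Additive` + `abel`). [folklore] -/
private theorem inv_mul_mul_mul_inv_cancel {G : Type*} [CommGroup G] (a₁ a₂ t₁ t₂ : G) :
    a₁⁻¹ * (a₂⁻¹ * (t₁ * t₂)) * (a₂⁻¹ * t₂)⁻¹ = a₁⁻¹ * t₁ := by
  have h : ∀ x₁ x₂ y₁ y₂ : Additive G, -x₁ + (-x₂ + (y₁ + y₂)) + -(-x₂ + y₂) = -x₁ + y₁ := by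
    intros; abel
  exact h (Additive.ofMul a₁) (Additive.ofMul a₂) (Additive.ofMul t₁) (Additive.ofMul t₂)

/-! ### §2 Additivity of `IsLambdaOfAt` -/

/-- Rank bookkeeping: the translate-tensor-dual module `t_P^*𝒪(Θ) ⊗ 𝒪(Θ)⁻¹` of the fibre has rank one.
[cite: MumfordFogartyKirwan1994, Ch. 6 §2 Definition 6.2 (p. 120)] -/
theorem hasRank_translateTensorDual (Θ : CartierDivisor (A.fibre s).toAbelianVariety.X.left)
    (P : (A.fibre s).toAbelianVariety.Points Ω) :
    HasRank (tensorObj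
      ((Scheme.Modules.pullback ((A.fibre s).toAbelianVariety.translation P).left).obj (A.lineBundleOfDivisor s Θ))
      (Modules.dual (A.lineBundleOfDivisor s Θ))) 1 :=
  hasRank_tensorObj_one (hasRank_pullback _ Θ.toUnitCocycle.hasRank_lineBundle) (hasRank_dual Θ.toUnitCocycle.hasRank_lineBundle)

section Additive

variable [IsReduced S] [IsLocallyNoetherian S]
  (hD : Nonempty ((Scheme.Modules.pullback (DualPair.unitHatSlice D)).obj D.P ≅ SheafOfModules.unit _))

include hD in
/-- **`IsLambdaOfAt` IS ADDITIVE** ([MumfordFogartyKirwan1994] Def. 6.2: `Λ(L ⊗ M) = Λ(L) + Λ(M)`; [MumfordAV1970] §8 (iv)): if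
`λ̄₁ = Λ(𝒪(Θ₁))` and `λ̄₂ = Λ(𝒪(Θ₂))` at the geometric point `s`, then `λ̄₁·λ̄₂ = Λ(𝒪(Θ₁ + Θ₂))` at `s` — the slice of `𝒫` at
`λ̄₁(P)·λ̄₂(P)` is the tensor product of the slices (★ `nonempty_pullbackP_mul_iso`), and classes in `Ȟ¹(A_s, 𝒪^×)` add:
`[D_P(Θ₁)]·[D_P(Θ₂)] = [D_P(Θ₁ + Θ₂)]`. [cite: MumfordFogartyKirwan1994, Ch. 6 §2 Definition 6.2 (p. 120)]
[cite: MumfordAV1970, §8 (pp. 74–75)] -/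
theorem IsLambdaOfAt.mul_add {lam₁ lam₂ : A.X ⟶ D.hat.X} {Θ₁ Θ₂ : CartierDivisor (A.fibre s).toAbelianVariety.X.left}
    (h₁ : A.IsLambdaOfAt s D lam₁ Θ₁) (h₂ : A.IsLambdaOfAt s D lam₂ Θ₂) :
    A.IsLambdaOfAt s D (lam₁ * lam₂) (Θ₁ + Θ₂) := by
  intro P
  -- the three slices as `pullbackP` of the three values
  set g₁ : Over.mk s ⟶ D.hat.X :=
    (Over.homMk (A.fibrePointToLeft s P) (A.fibrePointToLeft_comp_hom s P) : Over.mk s ⟶ A.X) ≫ lam₁ with hg₁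
  set g₂ : Over.mk s ⟶ D.hat.X :=
    (Over.homMk (A.fibrePointToLeft s P) (A.fibrePointToLeft_comp_hom s P) : Over.mk s ⟶ A.X) ≫ lam₂ with hg₂
  have hv₁ : A.valueAt s D lam₁ P = g₁.left := A.valueAt_eq_homMk_comp_left D s lam₁ P
  have hv₂ : A.valueAt s D lam₂ P = g₂.left := A.valueAt_eq_homMk_comp_left D s lam₂ P
  have hv₁₂ : A.valueAt s D (lam₁ * lam₂) P = (g₁ * g₂).left := A.valueAt_mul D s lam₁ lam₂ P
  -- `𝒫|_{λ̄₁λ̄₂(P)} ≅ 𝒫|_{λ̄₁(P)} ⊗ 𝒫|_{λ̄₂(P)}`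
  obtain ⟨I⟩ := D.nonempty_pullbackP_mul_iso hD s g₁ g₂
  have e₁₂ : (Scheme.Modules.pullback (A.sliceAt s D (lam₁ * lam₂) P)).obj D.P = D.pullbackP s (g₁ * g₂).left (Over.w _) := by
    rw [sliceAt_obj_eq_pullbackP]; exact D.pullbackP_congr s hv₁₂ _ _
  have e₁ : (Scheme.Modules.pullback (A.sliceAt s D lam₁ P)).obj D.P = D.pullbackP s g₁.left (Over.w g₁) := by
    rw [sliceAt_obj_eq_pullbackP]; exact D.pullbackP_congr s hv₁ _ _
  have e₂ : (Scheme.Modules.pullback (A.sliceAt s D lam₂ P)).obj D.P = D.pullbackP s g₂.left (Over.w g₂) := by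
    rw [sliceAt_obj_eq_pullbackP]; exact D.pullbackP_congr s hv₂ _ _
  obtain ⟨i₁⟩ := h₁ P
  obtain ⟨i₂⟩ := h₂ P
  rw [e₁] at i₁
  rw [e₂] at i₂
  rw [e₁₂]
  -- the tensor of the two witnesses
  have J : D.pullbackP s (g₁ * g₂).left (Over.w _) ≅
      tensorObj
        (tensorObj ((Scheme.Modules.pullback ((A.fibre s).toAbelianVariety.translation P).left).obj (A.lineBundleOfDivisor s Θ₁))
          (Modules.dual (A.lineBundleOfDivisor s Θ₁)))
        (tensorObj ((Scheme.Modules.pullback ((A.fibre s).toAbelianVariety.translation P).left).obj (A.lineBundleOfDivisor s Θ₂))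
          (Modules.dual (A.lineBundleOfDivisor s Θ₂))) :=
    I ≪≫ tensorMapIso i₁ i₂
  -- compare classes in `Ȟ¹(A_s, 𝒪^×)`
  have hr₁ := A.hasRank_translateTensorDual s Θ₁ P
  have hr₂ := A.hasRank_translateTensorDual s Θ₂ P
  have hr₁₂ := A.hasRank_translateTensorDual s (Θ₁ + Θ₂) P
  have hrT : HasRank (tensorObj
        (tensorObj ((Scheme.Modules.pullback ((A.fibre s).toAbelianVariety.translation P).left).obj (A.lineBundleOfDivisor s Θ₁))
          (Modules.dual (A.lineBundleOfDivisor s Θ₁)))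
        (tensorObj ((Scheme.Modules.pullback ((A.fibre s).toAbelianVariety.translation P).left).obj (A.lineBundleOfDivisor s Θ₂))
          (Modules.dual (A.lineBundleOfDivisor s Θ₂)))) 1 := hasRank_tensorObj_one hr₁ hr₂
  have hrP : HasRank (D.pullbackP s (g₁ * g₂).left (Over.w _)) 1 := D.hasRank_one_pullbackP s _ _
  refine (nonempty_iso_iff_detClass_eq hrP hr₁₂ (HasRank.isFiniteLocallyFree' hrP) (HasRank.isFiniteLocallyFree' hr₁₂)).2 ?_
  -- `[𝒫|_{λ̄₁λ̄₂(P)}] = [T₁ ⊗ T₂] = [T₁]·[T₂] = [D_P(Θ₁)]·[D_P(Θ₂)]`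
  have step1 := detClass_eq_of_iso J (HasRank.isFiniteLocallyFree' hrP) (HasRank.isFiniteLocallyFree' hrT)
  have step2 := detClass_tensorObj_of_hasRank_one hr₁ hr₂ (HasRank.isFiniteLocallyFree' hr₁)
    (HasRank.isFiniteLocallyFree' hr₂) (HasRank.isFiniteLocallyFree' hrT)
  have step3 := detClass_translateTensorDual_eq_cechClass_weilDiv (A.fibre s).toAbelianVariety Θ₁ P
    (HasRank.isFiniteLocallyFree' hr₁)
  have step4 := detClass_translateTensorDual_eq_cechClass_weilDiv (A.fibre s).toAbelianVariety Θ₂ P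
    (HasRank.isFiniteLocallyFree' hr₂)
  have step5 := detClass_translateTensorDual_eq_cechClass_weilDiv (A.fibre s).toAbelianVariety (Θ₁ + Θ₂) P
    (HasRank.isFiniteLocallyFree' hr₁₂)
  refine step1.trans (step2.trans ?_)
  refine (congrArg₂ (· * ·) step3 step4).trans (Eq.trans ?_ step5.symm)
  -- `[D_P(Θ₁)]·[D_P(Θ₂)] = [D_P(Θ₁ + Θ₂)]` in `Ȟ¹(A_s, 𝒪^×)`
  simp only [AbelianVariety.weilDiv, CartierDivisor.cechClass_add, CartierDivisor.cechClass_pullback,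
    cechClass_neg_eq_inv', map_mul, mul_inv]
  exact mul_mul_mul_comm _ _ _ _

include hD in
/-- **CANCELLATION**: if `λ̄₁·λ̄₂ = Λ(𝒪(Θ₁ + Θ₂))` and `λ̄₂ = Λ(𝒪(Θ₂))` at `s`, then `λ̄₁ = Λ(𝒪(Θ₁))` at `s` — the form the
Bezout assembly uses (`λ_B · (λ_B²)^k = λ_B^c`, `Θ_B + k•E ∼ Θ₀` ⇒ `λ_B = Λ(𝒪(Θ_B))`), with no inverse slices:
`[𝒫|_{λ̄₁(P)}] = [𝒫|_{λ̄₁λ̄₂(P)}]·[𝒫|_{λ̄₂(P)}]⁻¹ = [D_P(Θ₁+Θ₂)]·[D_P(Θ₂)]⁻¹ = [D_P(Θ₁)]`.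
[cite: MumfordFogartyKirwan1994, Ch. 6 §2 Definition 6.2 (p. 120)] [cite: MumfordAV1970, §8 (pp. 74–75)] -/
theorem IsLambdaOfAt.of_mul_add {lam₁ lam₂ : A.X ⟶ D.hat.X} {Θ₁ Θ₂ : CartierDivisor (A.fibre s).toAbelianVariety.X.left}
    (h₁₂ : A.IsLambdaOfAt s D (lam₁ * lam₂) (Θ₁ + Θ₂)) (h₂ : A.IsLambdaOfAt s D lam₂ Θ₂) :
    A.IsLambdaOfAt s D lam₁ Θ₁ := by
  intro P
  set g₁ : Over.mk s ⟶ D.hat.X :=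
    (Over.homMk (A.fibrePointToLeft s P) (A.fibrePointToLeft_comp_hom s P) : Over.mk s ⟶ A.X) ≫ lam₁ with hg₁
  set g₂ : Over.mk s ⟶ D.hat.X :=
    (Over.homMk (A.fibrePointToLeft s P) (A.fibrePointToLeft_comp_hom s P) : Over.mk s ⟶ A.X) ≫ lam₂ with hg₂
  have hv₁ : A.valueAt s D lam₁ P = g₁.left := A.valueAt_eq_homMk_comp_left D s lam₁ P
  have hv₂ : A.valueAt s D lam₂ P = g₂.left := A.valueAt_eq_homMk_comp_left D s lam₂ P
  have hv₁₂ : A.valueAt s D (lam₁ * lam₂) P = (g₁ * g₂).left := A.valueAt_mul D s lam₁ lam₂ P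
  obtain ⟨I⟩ := D.nonempty_pullbackP_mul_iso hD s g₁ g₂
  have e₁₂ : (Scheme.Modules.pullback (A.sliceAt s D (lam₁ * lam₂) P)).obj D.P = D.pullbackP s (g₁ * g₂).left (Over.w _) := by
    rw [sliceAt_obj_eq_pullbackP]; exact D.pullbackP_congr s hv₁₂ _ _
  have e₁ : (Scheme.Modules.pullback (A.sliceAt s D lam₁ P)).obj D.P = D.pullbackP s g₁.left (Over.w g₁) := by
    rw [sliceAt_obj_eq_pullbackP]; exact D.pullbackP_congr s hv₁ _ _
  have e₂ : (Scheme.Modules.pullback (A.sliceAt s D lam₂ P)).obj D.P = D.pullbackP s g₂.left (Over.w g₂) := by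
    rw [sliceAt_obj_eq_pullbackP]; exact D.pullbackP_congr s hv₂ _ _
  obtain ⟨i₁₂⟩ := h₁₂ P
  obtain ⟨i₂⟩ := h₂ P
  rw [e₁₂] at i₁₂
  rw [e₂] at i₂
  rw [e₁]
  have hr₁ := A.hasRank_translateTensorDual s Θ₁ P
  have hr₂ := A.hasRank_translateTensorDual s Θ₂ P
  have hr₁₂ := A.hasRank_translateTensorDual s (Θ₁ + Θ₂) P
  have hP₁ : HasRank (D.pullbackP s g₁.left (Over.w g₁)) 1 := D.hasRank_one_pullbackP s _ _
  have hP₂ : HasRank (D.pullbackP s g₂.left (Over.w g₂)) 1 := D.hasRank_one_pullbackP s _ _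
  have hP₁₂ : HasRank (D.pullbackP s (g₁ * g₂).left (Over.w _)) 1 := D.hasRank_one_pullbackP s _ _
  have hT : HasRank (tensorObj (D.pullbackP s g₁.left (Over.w g₁)) (D.pullbackP s g₂.left (Over.w g₂))) 1 :=
    hasRank_tensorObj_one hP₁ hP₂
  refine (nonempty_iso_iff_detClass_eq hP₁ hr₁ (HasRank.isFiniteLocallyFree' hP₁) (HasRank.isFiniteLocallyFree' hr₁)).2 ?_
  -- `[P₁₂] = [P₁]·[P₂]`, `[P₁₂] = [D_P(Θ₁+Θ₂)]`, `[P₂] = [D_P(Θ₂)]`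
  have s1 := detClass_eq_of_iso I (HasRank.isFiniteLocallyFree' hP₁₂) (HasRank.isFiniteLocallyFree' hT)
  have s2 := detClass_tensorObj_of_hasRank_one hP₁ hP₂ (HasRank.isFiniteLocallyFree' hP₁)
    (HasRank.isFiniteLocallyFree' hP₂) (HasRank.isFiniteLocallyFree' hT)
  have s3 := detClass_eq_of_iso i₁₂ (HasRank.isFiniteLocallyFree' hP₁₂) (HasRank.isFiniteLocallyFree' hr₁₂)
  have s4 := detClass_eq_of_iso i₂ (HasRank.isFiniteLocallyFree' hP₂) (HasRank.isFiniteLocallyFree' hr₂)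
  have s5 := detClass_translateTensorDual_eq_cechClass_weilDiv (A.fibre s).toAbelianVariety Θ₁ P
    (HasRank.isFiniteLocallyFree' hr₁)
  have s6 := detClass_translateTensorDual_eq_cechClass_weilDiv (A.fibre s).toAbelianVariety Θ₂ P
    (HasRank.isFiniteLocallyFree' hr₂)
  have s7 := detClass_translateTensorDual_eq_cechClass_weilDiv (A.fibre s).toAbelianVariety (Θ₁ + Θ₂) P
    (HasRank.isFiniteLocallyFree' hr₁₂)
  -- `[P₁] = [P₁₂]·[P₂]⁻¹`
  have key : detClass (HasRank.isFiniteLocallyFree' hP₁) =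
      detClass (HasRank.isFiniteLocallyFree' hP₁₂) * (detClass (HasRank.isFiniteLocallyFree' hP₂))⁻¹ :=
    eq_mul_inv_of_mul_eq (s2.symm.trans s1.symm)
  refine key.trans (Eq.trans ?_ s5.symm)
  refine (congrArg₂ (fun x y => x * y⁻¹) (s3.trans s7) (s4.trans s6)).trans ?_
  simp only [AbelianVariety.weilDiv, CartierDivisor.cechClass_add, CartierDivisor.cechClass_pullback,
    cechClass_neg_eq_inv', map_mul, mul_inv]
  -- `(a₁a₂)(b₁b₂)⁻¹ · (a₂ b₂⁻¹)⁻¹ = a₁ b₁⁻¹` after AC-normalisation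
  simp only [mul_assoc, mul_comm]
  exact inv_mul_mul_mul_inv_cancel _ _ _ _

end Additive

end AbelianSchemeOver

end Literature.AlgebraicGeometry.AbelianSchemes

end
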